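import Summits.ValiantsHypothesis.ValiantsHypothesis.Theorems.BarrierLeverChowCubeThetaHat

/-!
# Route BarrierLever — item 20195 `ChowHitsThinRowPartitionMinors` is FALSE, I: the thin rows of a
# GENERAL product of affine forms (row formulas)

Helper file (`--supports stmt-ValiantsHypothesis-20195`; cell valiant-natproofs, rung V4, 𝒟-side;
seat val-np-p2 gen 9).  Closes NO item; definition-free.  First file of the kernel REFUTATION of items
20195 / 20172 / 20239 (memo HOME/val-np-p2/g9/REFUTATION-20195-valnp2-g9.md): the coefficient identities
for the rows of size `≤ 2` of the partition matrix of an ARBITRARY product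
`∏_k ℓ_k`, `ℓ_k = 1 + Σ_a A k a · x_a + Σ_c B k c · y_c` (`x_a = X (castAdd h a)`, `y_c = X (natAdd h c)`,
`E U T = Σ_{a∈U} e_{x_a} + Σ_{c∈T} e_{y_c}` as in the items).  With the `y`-parts
`λ_k = 1 + Σ_c B k c · y_c` and the leave-out products `Λ_S = ∏_{k ∉ S} λ_k` (over any finite set `K` of
forms):

* `coeff_empty_prodForms`:  `coeff (E ∅ T) ∏ℓ = coeff (E ∅ T) Λ_∅`;
* `coeff_single_prodForms`: `coeff (E {a} T) ∏ℓ = Σ_k A k a · coeff (E ∅ T) Λ_{k}`;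
* `coeff_pair_prodForms`:   `coeff (E {a,b} T) ∏ℓ = Σ_k Σ_{k'≠k} A k a · A k' b · coeff (E ∅ T) Λ_{k,k'}`
  (induction on `K` with `ChowFactor.coeff_partitionExpo_mul_affine`; one-step forms
  `coeff_empty_mul_form`, `coeff_single_mul_form`, `coeff_pair_mul_form`, `coeff_prodY_insert`).

WHAT THIS IS NOT: bookkeeping; the refutation itself is in the sequel files; nothing on item 19717,
on crux stmt-ValiantsHypothesis-14610, or on `VP` versus `VNP`.
-/

set_option linter.dupNamespace false

namespace Summit.ValiantsHypothesis.ValiantsHypothesis.Theorems.BarrierLever.ChowStarve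

open Finset MvPolynomial
open Summit.ValiantsHypothesis.ValiantsHypothesis.Theorems.BarrierLever.ChowFactor
  (coeff_partitionExpo_mul_affineY coeff_partitionExpo_mul_affine)

variable {h : ℕ}

/-! ## 1. One more factor -/

/-- Appending one `y`-factor `λ_{k₀}` to a product of `y`-factors:
`coeff (E ∅ T) (∏_{insert k₀ S} λ) = coeff (E ∅ T) (∏_S λ) + Σ_{c ∈ T} B k₀ c · coeff (E ∅ (T.erase c)) (∏_S λ)`. -/
theorem coeff_prodY_insert (B : Fin (h + h) → Fin h → ℂ) (S : Finset (Fin (h + h))) (k₀ : Fin (h + h))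
    (hk₀ : k₀ ∉ S) (T : Finset (Fin h)) :
    coeff (∑ a ∈ (∅ : Finset (Fin h)), Finsupp.single (Fin.castAdd h a) 1 +
        ∑ c ∈ T, Finsupp.single (Fin.natAdd h c) 1)
        (∏ k ∈ insert k₀ S, ((1 + ∑ c, C (B k c) * X (Fin.natAdd h c)) : MvPolynomial (Fin (h + h)) ℂ)) =
      coeff (∑ a ∈ (∅ : Finset (Fin h)), Finsupp.single (Fin.castAdd h a) 1 +
          ∑ c ∈ T, Finsupp.single (Fin.natAdd h c) 1)
          (∏ k ∈ S, ((1 + ∑ c, C (B k c) * X (Fin.natAdd h c)) : MvPolynomial (Fin (h + h)) ℂ)) +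
        ∑ c ∈ T, B k₀ c * coeff (∑ a ∈ (∅ : Finset (Fin h)), Finsupp.single (Fin.castAdd h a) 1 +
          ∑ c' ∈ T.erase c, Finsupp.single (Fin.natAdd h c') 1)
          (∏ k ∈ S, ((1 + ∑ c, C (B k c) * X (Fin.natAdd h c)) : MvPolynomial (Fin (h + h)) ℂ)) := by
  classical
  rw [Finset.prod_insert hk₀, mul_comm, coeff_partitionExpo_mul_affineY]

/-- One more affine factor, row `∅`:
`coeff (E ∅ T) (f · ℓ_k) = coeff (E ∅ T) f + Σ_{c∈T} B k c · coeff (E ∅ (T.erase c)) f`. -/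
theorem coeff_empty_mul_form (f : MvPolynomial (Fin (h + h)) ℂ) (A B : Fin (h + h) → Fin h → ℂ)
    (k : Fin (h + h)) (T : Finset (Fin h)) :
    coeff (∑ a ∈ (∅ : Finset (Fin h)), Finsupp.single (Fin.castAdd h a) 1 +
        ∑ c ∈ T, Finsupp.single (Fin.natAdd h c) 1)
        (f * (C 1 + ∑ a, C (A k a) * X (Fin.castAdd h a) + ∑ c, C (B k c) * X (Fin.natAdd h c))) =
      coeff (∑ a ∈ (∅ : Finset (Fin h)), Finsupp.single (Fin.castAdd h a) 1 +
          ∑ c ∈ T, Finsupp.single (Fin.natAdd h c) 1) f +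
        ∑ c ∈ T, B k c * coeff (∑ a ∈ (∅ : Finset (Fin h)), Finsupp.single (Fin.castAdd h a) 1 +
          ∑ c' ∈ T.erase c, Finsupp.single (Fin.natAdd h c') 1) f := by
  classical
  rw [coeff_partitionExpo_mul_affine, one_mul]
  have h0 : ∑ a ∈ (∅ : Finset (Fin h)), A k a *
      coeff (∑ a' ∈ (∅ : Finset (Fin h)).erase a, Finsupp.single (Fin.castAdd h a') 1 +
        ∑ c ∈ T, Finsupp.single (Fin.natAdd h c) 1) f = 0 := Finset.sum_empty
  rw [h0, add_zero]

/-- One more affine factor, row `{a}`: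
`coeff (E {a} T) (f · ℓ_k) = coeff (E {a} T) f + A k a · coeff (E ∅ T) f + Σ_{c∈T} B k c · coeff (E {a} (T.erase c)) f`. -/
theorem coeff_single_mul_form (f : MvPolynomial (Fin (h + h)) ℂ) (A B : Fin (h + h) → Fin h → ℂ)
    (k : Fin (h + h)) (a : Fin h) (T : Finset (Fin h)) :
    coeff (∑ a' ∈ ({a} : Finset (Fin h)), Finsupp.single (Fin.castAdd h a') 1 +
        ∑ c ∈ T, Finsupp.single (Fin.natAdd h c) 1)
        (f * (C 1 + ∑ a, C (A k a) * X (Fin.castAdd h a) + ∑ c, C (B k c) * X (Fin.natAdd h c))) =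
      coeff (∑ a' ∈ ({a} : Finset (Fin h)), Finsupp.single (Fin.castAdd h a') 1 +
          ∑ c ∈ T, Finsupp.single (Fin.natAdd h c) 1) f +
        A k a * coeff (∑ a ∈ (∅ : Finset (Fin h)), Finsupp.single (Fin.castAdd h a) 1 +
          ∑ c ∈ T, Finsupp.single (Fin.natAdd h c) 1) f +
        ∑ c ∈ T, B k c * coeff (∑ a' ∈ ({a} : Finset (Fin h)), Finsupp.single (Fin.castAdd h a') 1 +
          ∑ c' ∈ T.erase c, Finsupp.single (Fin.natAdd h c') 1) f := by
  classical
  rw [coeff_partitionExpo_mul_affine, one_mul]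
  have h1 : ∑ a'' ∈ ({a} : Finset (Fin h)), A k a'' *
      coeff (∑ a' ∈ ({a} : Finset (Fin h)).erase a'', Finsupp.single (Fin.castAdd h a') 1 +
        ∑ c ∈ T, Finsupp.single (Fin.natAdd h c) 1) f =
      A k a * coeff (∑ a ∈ (∅ : Finset (Fin h)), Finsupp.single (Fin.castAdd h a) 1 +
          ∑ c ∈ T, Finsupp.single (Fin.natAdd h c) 1) f := by
    rw [Finset.sum_singleton, Finset.erase_singleton]
  rw [h1]

/-- One more affine factor, row `{a, b}` (`a ≠ b`):
`coeff (E {a,b} T) (f · ℓ_k) = coeff (E {a,b} T) f + A k a · coeff (E {b} T) f + A k b · coeff (E {a} T) f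
  + Σ_{c∈T} B k c · coeff (E {a,b} (T.erase c)) f`. -/
theorem coeff_pair_mul_form (f : MvPolynomial (Fin (h + h)) ℂ) (A B : Fin (h + h) → Fin h → ℂ)
    (k : Fin (h + h)) (a b : Fin h) (hab : a ≠ b) (T : Finset (Fin h)) :
    coeff (∑ a' ∈ ({a, b} : Finset (Fin h)), Finsupp.single (Fin.castAdd h a') 1 +
        ∑ c ∈ T, Finsupp.single (Fin.natAdd h c) 1)
        (f * (C 1 + ∑ a, C (A k a) * X (Fin.castAdd h a) + ∑ c, C (B k c) * X (Fin.natAdd h c))) =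
      coeff (∑ a' ∈ ({a, b} : Finset (Fin h)), Finsupp.single (Fin.castAdd h a') 1 +
          ∑ c ∈ T, Finsupp.single (Fin.natAdd h c) 1) f +
        A k a * coeff (∑ a' ∈ ({b} : Finset (Fin h)), Finsupp.single (Fin.castAdd h a') 1 +
          ∑ c ∈ T, Finsupp.single (Fin.natAdd h c) 1) f +
        A k b * coeff (∑ a' ∈ ({a} : Finset (Fin h)), Finsupp.single (Fin.castAdd h a') 1 +
          ∑ c ∈ T, Finsupp.single (Fin.natAdd h c) 1) f +
        ∑ c ∈ T, B k c * coeff (∑ a' ∈ ({a, b} : Finset (Fin h)), Finsupp.single (Fin.castAdd h a') 1 +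
          ∑ c' ∈ T.erase c, Finsupp.single (Fin.natAdd h c') 1) f := by
  classical
  rw [coeff_partitionExpo_mul_affine, one_mul]
  have hpa : ({a, b} : Finset (Fin h)).erase a = {b} := by
    rw [Finset.erase_insert (Finset.notMem_singleton.mpr hab)]
  have hpb : ({a, b} : Finset (Fin h)).erase b = {a} := by
    rw [Finset.erase_insert_of_ne hab, Finset.erase_singleton]
    rfl
  have h2 : ∑ a'' ∈ ({a, b} : Finset (Fin h)), A k a'' *
      coeff (∑ a' ∈ ({a, b} : Finset (Fin h)).erase a'', Finsupp.single (Fin.castAdd h a') 1 +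
        ∑ c ∈ T, Finsupp.single (Fin.natAdd h c) 1) f =
      A k a * coeff (∑ a' ∈ ({b} : Finset (Fin h)), Finsupp.single (Fin.castAdd h a') 1 +
          ∑ c ∈ T, Finsupp.single (Fin.natAdd h c) 1) f +
        A k b * coeff (∑ a' ∈ ({a} : Finset (Fin h)), Finsupp.single (Fin.castAdd h a') 1 +
          ∑ c ∈ T, Finsupp.single (Fin.natAdd h c) 1) f := by
    rw [Finset.sum_pair hab, hpa, hpb]
  rw [h2]
  ring

/-! ## 2. Row formulas for an arbitrary product of affine forms -/

/-- **Row `∅`**: the `x`-free coefficients of `∏_{k∈K} ℓ_k` are those of the product of the `y`-parts. -/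
theorem coeff_empty_prodForms (A B : Fin (h + h) → Fin h → ℂ) (K : Finset (Fin (h + h)))
    (T : Finset (Fin h)) :
    coeff (∑ a ∈ (∅ : Finset (Fin h)), Finsupp.single (Fin.castAdd h a) 1 +
        ∑ c ∈ T, Finsupp.single (Fin.natAdd h c) 1)
        (∏ k ∈ K, ((C 1 + ∑ a, C (A k a) * X (Fin.castAdd h a) + ∑ c, C (B k c) * X (Fin.natAdd h c)) :
          MvPolynomial (Fin (h + h)) ℂ)) =
      coeff (∑ a ∈ (∅ : Finset (Fin h)), Finsupp.single (Fin.castAdd h a) 1 +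
        ∑ c ∈ T, Finsupp.single (Fin.natAdd h c) 1)
        (∏ k ∈ K, ((1 + ∑ c, C (B k c) * X (Fin.natAdd h c)) : MvPolynomial (Fin (h + h)) ℂ)) := by
  classical
  induction K using Finset.induction_on generalizing T with
  | empty => simp
  | insert k₀ K hk₀ ih =>
    rw [Finset.prod_insert hk₀, mul_comm, coeff_empty_mul_form, coeff_prodY_insert B K k₀ hk₀ T, ih T]
    refine congrArg _ (Finset.sum_congr rfl fun c _ => ?_)
    rw [ih (T.erase c)]

/-- **Row `{a}`**: `coeff (E {a} T) ∏_{k∈K} ℓ_k = Σ_{k ∈ K} A k a · coeff (E ∅ T) (∏_{K.erase k} λ)`. -/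
theorem coeff_single_prodForms (A B : Fin (h + h) → Fin h → ℂ) (K : Finset (Fin (h + h))) (a : Fin h)
    (T : Finset (Fin h)) :
    coeff (∑ a' ∈ ({a} : Finset (Fin h)), Finsupp.single (Fin.castAdd h a') 1 +
        ∑ c ∈ T, Finsupp.single (Fin.natAdd h c) 1)
        (∏ k ∈ K, ((C 1 + ∑ a, C (A k a) * X (Fin.castAdd h a) + ∑ c, C (B k c) * X (Fin.natAdd h c)) :
          MvPolynomial (Fin (h + h)) ℂ)) =
      ∑ k ∈ K, A k a * coeff (∑ a ∈ (∅ : Finset (Fin h)), Finsupp.single (Fin.castAdd h a) 1 +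
        ∑ c ∈ T, Finsupp.single (Fin.natAdd h c) 1)
        (∏ k' ∈ K.erase k, ((1 + ∑ c, C (B k' c) * X (Fin.natAdd h c)) : MvPolynomial (Fin (h + h)) ℂ)) := by
  classical
  induction K using Finset.induction_on generalizing T with
  | empty =>
    rw [Finset.prod_empty, Finset.sum_empty, coeff_one, if_neg]
    intro h0
    have h1 := congrArg (fun v : Fin (h + h) →₀ ℕ => v (Fin.castAdd h a)) h0
    simp only [Finsupp.coe_zero, Pi.zero_apply,
      ProductStateSums.partitionExpo_apply_castAdd, Finset.mem_singleton, if_true] at h1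
    exact one_ne_zero h1.symm
  | insert k₀ K hk₀ ih =>
    rw [Finset.prod_insert hk₀, mul_comm, coeff_single_mul_form, coeff_empty_prodForms, ih T]
    simp_rw [ih (T.erase _)]
    -- the right-hand side
    rw [Finset.sum_insert hk₀, Finset.erase_insert hk₀]
    have hR : ∑ k ∈ K, A k a * coeff (∑ a ∈ (∅ : Finset (Fin h)), Finsupp.single (Fin.castAdd h a) 1 +
            ∑ c ∈ T, Finsupp.single (Fin.natAdd h c) 1)
            (∏ k' ∈ (insert k₀ K).erase k,
              ((1 + ∑ c, C (B k' c) * X (Fin.natAdd h c)) : MvPolynomial (Fin (h + h)) ℂ)) =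
        ∑ k ∈ K, (A k a * coeff (∑ a ∈ (∅ : Finset (Fin h)), Finsupp.single (Fin.castAdd h a) 1 +
              ∑ c ∈ T, Finsupp.single (Fin.natAdd h c) 1)
              (∏ k' ∈ K.erase k, ((1 + ∑ c, C (B k' c) * X (Fin.natAdd h c)) :
                MvPolynomial (Fin (h + h)) ℂ)) +
            ∑ c ∈ T, B k₀ c * (A k a * coeff (∑ a ∈ (∅ : Finset (Fin h)), Finsupp.single (Fin.castAdd h a) 1 +
              ∑ c' ∈ T.erase c, Finsupp.single (Fin.natAdd h c') 1)
              (∏ k' ∈ K.erase k, ((1 + ∑ c, C (B k' c) * X (Fin.natAdd h c)) :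
                MvPolynomial (Fin (h + h)) ℂ)))) := by
      refine Finset.sum_congr rfl fun k hk => ?_
      rw [Finset.erase_insert_of_ne (fun e => hk₀ (by rw [e]; exact hk)),
        coeff_prodY_insert B (K.erase k) k₀ (fun hm => hk₀ (Finset.mem_of_mem_erase hm)) T, mul_add,
        Finset.mul_sum]
      refine congrArg _ (Finset.sum_congr rfl fun c _ => ?_)
      ring
    have hC : ∑ c ∈ T, B k₀ c * ∑ k ∈ K, A k a *
            coeff (∑ a ∈ (∅ : Finset (Fin h)), Finsupp.single (Fin.castAdd h a) 1 +
              ∑ c' ∈ T.erase c, Finsupp.single (Fin.natAdd h c') 1)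
              (∏ k' ∈ K.erase k, ((1 + ∑ c, C (B k' c) * X (Fin.natAdd h c)) :
                MvPolynomial (Fin (h + h)) ℂ)) =
        ∑ k ∈ K, ∑ c ∈ T, B k₀ c * (A k a * coeff (∑ a ∈ (∅ : Finset (Fin h)), Finsupp.single (Fin.castAdd h a) 1 +
              ∑ c' ∈ T.erase c, Finsupp.single (Fin.natAdd h c') 1)
              (∏ k' ∈ K.erase k, ((1 + ∑ c, C (B k' c) * X (Fin.natAdd h c)) :
                MvPolynomial (Fin (h + h)) ℂ))) := by
      rw [Finset.sum_comm]
      exact Finset.sum_congr rfl fun c _ => Finset.mul_sum _ _ _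
    rw [hR, Finset.sum_add_distrib, hC]
    ring

/-- **Row `{a, b}`** (`a ≠ b`):
`coeff (E {a,b} T) ∏_{k∈K} ℓ_k = Σ_{k ∈ K} Σ_{k' ∈ K.erase k} A k a · A k' b · coeff (E ∅ T) (∏_{(K.erase k).erase k'} λ)`. -/
theorem coeff_pair_prodForms (A B : Fin (h + h) → Fin h → ℂ) (K : Finset (Fin (h + h))) (a b : Fin h)
    (hab : a ≠ b) (T : Finset (Fin h)) :
    coeff (∑ a' ∈ ({a, b} : Finset (Fin h)), Finsupp.single (Fin.castAdd h a') 1 +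
        ∑ c ∈ T, Finsupp.single (Fin.natAdd h c) 1)
        (∏ k ∈ K, ((C 1 + ∑ a, C (A k a) * X (Fin.castAdd h a) + ∑ c, C (B k c) * X (Fin.natAdd h c)) :
          MvPolynomial (Fin (h + h)) ℂ)) =
      ∑ k ∈ K, ∑ k' ∈ K.erase k, A k a * A k' b *
        coeff (∑ a ∈ (∅ : Finset (Fin h)), Finsupp.single (Fin.castAdd h a) 1 +
          ∑ c ∈ T, Finsupp.single (Fin.natAdd h c) 1)
          (∏ j ∈ (K.erase k).erase k', ((1 + ∑ c, C (B j c) * X (Fin.natAdd h c)) :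
            MvPolynomial (Fin (h + h)) ℂ)) := by
  classical
  induction K using Finset.induction_on generalizing T with
  | empty =>
    rw [Finset.prod_empty, Finset.sum_empty, coeff_one, if_neg]
    intro h0
    have h1 := congrArg (fun v : Fin (h + h) →₀ ℕ => v (Fin.castAdd h a)) h0
    simp only [Finsupp.coe_zero, Pi.zero_apply,
      ProductStateSums.partitionExpo_apply_castAdd, Finset.mem_insert, Finset.mem_singleton,
      true_or, if_true] at h1
    exact one_ne_zero h1.symm
  | insert k₀ K hk₀ ih =>
    rw [Finset.prod_insert hk₀, mul_comm, coeff_pair_mul_form _ A B k₀ a b hab, coeff_single_prodForms,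
      coeff_single_prodForms, ih T]
    simp_rw [ih (T.erase _)]
    -- the right-hand side: split `k = k₀` / `k ∈ K`, then `k' = k₀` / `k' ∈ K.erase k`
    rw [Finset.sum_insert hk₀, Finset.erase_insert hk₀]
    have hR : ∑ k ∈ K, ∑ k' ∈ (insert k₀ K).erase k, A k a * A k' b *
          coeff (∑ a ∈ (∅ : Finset (Fin h)), Finsupp.single (Fin.castAdd h a) 1 +
            ∑ c ∈ T, Finsupp.single (Fin.natAdd h c) 1)
            (∏ j ∈ ((insert k₀ K).erase k).erase k', ((1 + ∑ c, C (B j c) * X (Fin.natAdd h c)) :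
              MvPolynomial (Fin (h + h)) ℂ)) =
        ∑ k ∈ K, (A k a * A k₀ b *
            coeff (∑ a ∈ (∅ : Finset (Fin h)), Finsupp.single (Fin.castAdd h a) 1 +
              ∑ c ∈ T, Finsupp.single (Fin.natAdd h c) 1)
              (∏ j ∈ K.erase k, ((1 + ∑ c, C (B j c) * X (Fin.natAdd h c)) :
                MvPolynomial (Fin (h + h)) ℂ)) +
          ∑ k' ∈ K.erase k, (A k a * A k' b *
            coeff (∑ a ∈ (∅ : Finset (Fin h)), Finsupp.single (Fin.castAdd h a) 1 +
              ∑ c ∈ T, Finsupp.single (Fin.natAdd h c) 1)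
              (∏ j ∈ (K.erase k).erase k', ((1 + ∑ c, C (B j c) * X (Fin.natAdd h c)) :
                MvPolynomial (Fin (h + h)) ℂ)) +
            ∑ c ∈ T, B k₀ c * (A k a * A k' b *
              coeff (∑ a ∈ (∅ : Finset (Fin h)), Finsupp.single (Fin.castAdd h a) 1 +
                ∑ c' ∈ T.erase c, Finsupp.single (Fin.natAdd h c') 1)
                (∏ j ∈ (K.erase k).erase k', ((1 + ∑ c, C (B j c) * X (Fin.natAdd h c)) :
                  MvPolynomial (Fin (h + h)) ℂ))))) := by
      refine Finset.sum_congr rfl fun k hk => ?_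
      have hne : k₀ ≠ k := fun e => hk₀ (by rw [e]; exact hk)
      have hk₀' : k₀ ∉ K.erase k := fun hm => hk₀ (Finset.mem_of_mem_erase hm)
      rw [Finset.erase_insert_of_ne hne, Finset.sum_insert hk₀', Finset.erase_insert hk₀']
      refine congrArg _ (Finset.sum_congr rfl fun k' hk' => ?_)
      rw [Finset.erase_insert_of_ne (fun e => hk₀ (by rw [e]; exact Finset.mem_of_mem_erase hk')),
        coeff_prodY_insert B ((K.erase k).erase k') k₀
          (fun hm => hk₀ (Finset.mem_of_mem_erase (Finset.mem_of_mem_erase hm))) T, mul_add,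
        Finset.mul_sum]
      refine congrArg _ (Finset.sum_congr rfl fun c _ => ?_)
      ring
    have hC : ∑ c ∈ T, B k₀ c * ∑ k ∈ K, ∑ k' ∈ K.erase k, A k a * A k' b *
            coeff (∑ a ∈ (∅ : Finset (Fin h)), Finsupp.single (Fin.castAdd h a) 1 +
              ∑ c' ∈ T.erase c, Finsupp.single (Fin.natAdd h c') 1)
              (∏ j ∈ (K.erase k).erase k', ((1 + ∑ c, C (B j c) * X (Fin.natAdd h c)) :
                MvPolynomial (Fin (h + h)) ℂ)) =
        ∑ k ∈ K, ∑ k' ∈ K.erase k, ∑ c ∈ T, B k₀ c * (A k a * A k' b *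
              coeff (∑ a ∈ (∅ : Finset (Fin h)), Finsupp.single (Fin.castAdd h a) 1 +
                ∑ c' ∈ T.erase c, Finsupp.single (Fin.natAdd h c') 1)
                (∏ j ∈ (K.erase k).erase k', ((1 + ∑ c, C (B j c) * X (Fin.natAdd h c)) :
                  MvPolynomial (Fin (h + h)) ℂ))) := by
      simp_rw [Finset.mul_sum]
      rw [Finset.sum_comm]
      exact Finset.sum_congr rfl fun k _ => Finset.sum_comm
    have hB : A k₀ b * ∑ k ∈ K, A k a *
            coeff (∑ a ∈ (∅ : Finset (Fin h)), Finsupp.single (Fin.castAdd h a) 1 +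
              ∑ c ∈ T, Finsupp.single (Fin.natAdd h c) 1)
              (∏ k' ∈ K.erase k, ((1 + ∑ c, C (B k' c) * X (Fin.natAdd h c)) :
                MvPolynomial (Fin (h + h)) ℂ)) =
        ∑ k ∈ K, A k a * A k₀ b *
            coeff (∑ a ∈ (∅ : Finset (Fin h)), Finsupp.single (Fin.castAdd h a) 1 +
              ∑ c ∈ T, Finsupp.single (Fin.natAdd h c) 1)
              (∏ j ∈ K.erase k, ((1 + ∑ c, C (B j c) * X (Fin.natAdd h c)) :
                MvPolynomial (Fin (h + h)) ℂ)) := by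
      rw [Finset.mul_sum]
      exact Finset.sum_congr rfl fun k _ => by ring
    have hA : A k₀ a * ∑ k ∈ K, A k b *
            coeff (∑ a ∈ (∅ : Finset (Fin h)), Finsupp.single (Fin.castAdd h a) 1 +
              ∑ c ∈ T, Finsupp.single (Fin.natAdd h c) 1)
              (∏ k' ∈ K.erase k, ((1 + ∑ c, C (B k' c) * X (Fin.natAdd h c)) :
                MvPolynomial (Fin (h + h)) ℂ)) =
        ∑ k' ∈ K, A k₀ a * A k' b *
            coeff (∑ a ∈ (∅ : Finset (Fin h)), Finsupp.single (Fin.castAdd h a) 1 +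
              ∑ c ∈ T, Finsupp.single (Fin.natAdd h c) 1)
              (∏ j ∈ K.erase k', ((1 + ∑ c, C (B j c) * X (Fin.natAdd h c)) :
                MvPolynomial (Fin (h + h)) ℂ)) := by
      rw [Finset.mul_sum]
      exact Finset.sum_congr rfl fun k _ => by ring
    rw [hR, hC, hB, hA]
    simp_rw [Finset.sum_add_distrib]
    ring

end Summit.ValiantsHypothesis.ValiantsHypothesis.Theorems.BarrierLever.ChowStarve
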